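import Mathlib
import Literature.Analysis.SpecialFunctions.LegendrePolynomialsBonnet
import HarnessLib

/-!
# The normalised Legendre polynomials form a Hilbert basis of `L²([-1, 1])`

Topic `Literature/Analysis/SpecialFunctions` (namespace `Literature.Analysis.SpecialFunctions`),
continuing `LegendrePolynomials.lean` / `LegendrePolynomialsBonnet.lean` (Rodrigues' formula,
orthogonality `∫_{-1}^1 P_n P_m = 0`, norms `∫_{-1}^1 P_n² = 2/(2n+1)`, expansion of polynomials in
the `P_k`). Everything here is PROVED; no definition of a notion wider than needed, no named fact.

* `legendreMeasure` — Lebesgue measure restricted to `[-1, 1]` (a finite, weakly regular measure on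
  `ℝ`, total mass `2`); `L²([-1,1]) := Lp ℂ 2 legendreMeasure` (complex scalars, as needed for
  Fourier analysis downstream);
* `legendreFn n x = √((2n+1)/2) · P_n(x)` (complex-valued), `legendreL2 n` its class in `L²([-1,1])`;
* `integral_conj_legendreFn_mul_legendreFn` — `∫_{[-1,1]} conj(P̃_n) P̃_m = δ_{nm}`;
  `orthonormal_legendreL2`;
* `polynomialL2 p` (the class of a real polynomial), `polynomialL2_mem_span` — every polynomial
  lies in the span of the `P̃_k`;
  `polynomial_dense_L2` — polynomials are dense in `L²([-1,1])` (Weierstrass on `[-1,1]` for real and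
  imaginary parts + density of bounded continuous functions in `L²` of a finite weakly regular
  measure); hence `span_legendreL2_dense`;
* `legendreBasis : HilbertBasis ℕ ℂ L²([-1,1])` with `legendreBasis n = legendreL2 n`
  (`coe_legendreBasis`) and the coefficient formula
  `legendreBasis.repr f n = ∫_{[-1,1]} conj(P̃_n x) f x dx` (`legendreBasis_repr`).

This is the case `ν = 0`, `m = 0` of the complete orthonormal systems of §5.2.1 of
Dafermos–Rodnianski–Shlapentokh-Rothman (arXiv:1402.7034): for `ν = 0` the oblate spheroidal
harmonics reduce to the spherical harmonics, and the axisymmetric ones are `Y_{0ℓ}(θ) ∝ P_ℓ(cos θ)`,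
`∫_0^π |f(cos θ)|² sin θ dθ = ∫_{-1}^1 |f(x)|² dx`. It is the unperturbed Hilbert basis from which the
spheroidal eigenbases (`ν ≠ 0`) are obtained by a bounded perturbation.

## References

* G. E. Andrews, R. Askey, R. Roy, *Special Functions*, CUP 1999, §2.5 (Legendre/Jacobi
  orthogonality), as in `LegendrePolynomials.lean`. [AndrewsAskeyRoy1999]
* M. Reed, B. Simon, *Methods of Modern Mathematical Physics I* (1980), §II.3 (orthonormal bases;
  the Legendre polynomials as an orthonormal basis of `L²[-1,1]` obtained from `1, x, x², …`).
  [ReedSimonI1980]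
* M. Dafermos, I. Rodnianski, Y. Shlapentokh-Rothman, arXiv:1402.7034 = Ann. of Math. 183 (2016),
  §5.2.1. [DafermosRodnianskiShlapentokhrothman2014]
-/

noncomputable section

open MeasureTheory Set Filter Topology Polynomial
open scoped ENNReal InnerProductSpace ComplexConjugate

namespace Literature.Analysis.SpecialFunctions

/-! ### The measure space `[-1, 1]` and its `L²` -/

/-- Lebesgue measure restricted to `[-1, 1]`, as a measure on `ℝ`. [folklore] -/
abbrev legendreMeasure : Measure ℝ := volume.restrict (Icc (-1 : ℝ) 1)

/-- `[-1, 1]` has total mass `2`. [folklore] -/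
theorem legendreMeasure_univ : legendreMeasure univ = 2 := by
  rw [Measure.restrict_apply_univ, Real.volume_Icc]
  norm_num

/-- Lebesgue measure restricted to `[-1, 1]` is weakly regular (restriction of a regular measure to a
set of finite measure). [folklore] -/
instance legendreMeasure.weaklyRegular : legendreMeasure.WeaklyRegular :=
  Measure.WeaklyRegular.restrict_of_measure_ne_top (by simp [Real.volume_Icc])

/-- A property holding on `[-1, 1]` holds `legendreMeasure`-a.e. [folklore] -/
theorem ae_legendreMeasure_of_forall_mem {p : ℝ → Prop} (h : ∀ x ∈ Icc (-1 : ℝ) 1, p x) :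
    ∀ᵐ x ∂legendreMeasure, p x :=
  (ae_restrict_iff' measurableSet_Icc).2 (Eventually.of_forall h)

/-- A continuous function `ℝ → ℂ` is in every `Lᵖ([-1, 1])` (it is bounded on the compact
interval and the measure is finite). [folklore] -/
theorem memLp_legendreMeasure_of_continuous {f : ℝ → ℂ} (hf : Continuous f) (p : ℝ≥0∞) :
    MemLp f p legendreMeasure := by
  obtain ⟨C, hC⟩ := isCompact_Icc.exists_bound_of_continuousOn (hf.continuousOn (s := Icc (-1 : ℝ) 1))
  have h : MemLp f ∞ legendreMeasure :=
    memLp_top_of_bound hf.aestronglyMeasurable C (ae_legendreMeasure_of_forall_mem hC)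
  exact h.mono_exponent le_top

/-- The `L²([-1,1])`-norm of (the class of) a function bounded by `C` on `[-1, 1]` is at most
`√2 · C`. [folklore] -/
theorem norm_toLp_le_of_bound {f : ℝ → ℂ} (hf : MemLp f 2 legendreMeasure) {C : ℝ} (hC : 0 ≤ C)
    (hb : ∀ x ∈ Icc (-1 : ℝ) 1, ‖f x‖ ≤ C) : ‖hf.toLp f‖ ≤ Real.sqrt 2 * C := by
  rw [Lp.norm_toLp]
  have h := eLpNorm_le_of_ae_bound (p := 2) (μ := legendreMeasure) (ae_legendreMeasure_of_forall_mem hb)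
  rw [legendreMeasure_univ] at h
  have h2 : (2 : ℝ≥0∞) ^ (2 : ℝ≥0∞).toReal⁻¹ * ENNReal.ofReal C = ENNReal.ofReal (Real.sqrt 2 * C) := by
    rw [ENNReal.toReal_ofNat, ENNReal.ofReal_mul (Real.sqrt_nonneg _), Real.sqrt_eq_rpow,
      ← ENNReal.ofReal_rpow_of_pos (by norm_num : (0 : ℝ) < 2), ENNReal.ofReal_ofNat, one_div]
  rw [h2] at h
  exact (ENNReal.toReal_mono ENNReal.ofReal_ne_top h).trans (by rw [ENNReal.toReal_ofReal (by positivity)])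

/-! ### The normalised Legendre functions -/

/-- The normalisation constant `c_n = √((2n+1)/2)` (so that `c_n² · 2/(2n+1) = 1`). [folklore] -/
def legendreNormConst (n : ℕ) : ℝ := Real.sqrt ((2 * n + 1) / 2)

/-- `c_n > 0`. [folklore] -/
theorem legendreNormConst_pos (n : ℕ) : 0 < legendreNormConst n :=
  Real.sqrt_pos.2 (by positivity)

/-- `c_n² = (2n+1)/2`. [folklore] -/
theorem legendreNormConst_sq (n : ℕ) : legendreNormConst n ^ 2 = (2 * n + 1) / 2 :=
  Real.sq_sqrt (by positivity)

/-- `c_n² · (2 / (2n+1)) = 1`. [folklore] -/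
theorem legendreNormConst_sq_mul (n : ℕ) : legendreNormConst n ^ 2 * (2 / (2 * n + 1)) = 1 := by
  rw [legendreNormConst_sq]
  have : (2 * (n : ℝ) + 1) ≠ 0 := by positivity
  field_simp

/-- The normalised Legendre function `P̃_n(x) = c_n P_n(x)`, complex-valued. [folklore] -/
def legendreFn (n : ℕ) (x : ℝ) : ℂ := ((legendreNormConst n * (legendre n).eval x : ℝ) : ℂ)

/-- Unfolding `P̃_n`. [folklore] -/
theorem legendreFn_apply (n : ℕ) (x : ℝ) :
    legendreFn n x = ((legendreNormConst n * (legendre n).eval x : ℝ) : ℂ) := rfl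

/-- `P̃_n` is continuous. [folklore] -/
theorem continuous_legendreFn (n : ℕ) : Continuous (legendreFn n) :=
  Complex.continuous_ofReal.comp (continuous_const.mul (legendre n).continuous)

/-- `P̃_n` is real-valued. [folklore] -/
theorem conj_legendreFn (n : ℕ) (x : ℝ) : conj (legendreFn n x) = legendreFn n x := by
  rw [legendreFn_apply, Complex.conj_ofReal]

/-- `P̃_n ∈ L²([-1, 1])`. [folklore] -/
theorem memLp_legendreFn (n : ℕ) : MemLp (legendreFn n) 2 legendreMeasure :=
  memLp_legendreMeasure_of_continuous (continuous_legendreFn n) 2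

/-- The class of `P̃_n` in `L²([-1, 1])`. [folklore] -/
def legendreL2 (n : ℕ) : Lp ℂ 2 legendreMeasure := (memLp_legendreFn n).toLp (legendreFn n)

/-- The class `legendreL2 n` is represented by `P̃_n`. [folklore] -/
theorem coeFn_legendreL2 (n : ℕ) : (legendreL2 n : ℝ → ℂ) =ᵐ[legendreMeasure] legendreFn n :=
  MemLp.coeFn_toLp _

/-- Simultaneous a.e. representatives of all the `P̃_n`. [folklore] -/
theorem ae_forall_coeFn_legendreL2 :
    ∀ᵐ x ∂legendreMeasure, ∀ n, (legendreL2 n : ℝ → ℂ) x = legendreFn n x :=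
  ae_all_iff.2 fun n ↦ coeFn_legendreL2 n

/-! ### Orthonormality -/

/-- Set integrals over `[-1, 1]` are interval integrals. [folklore] -/
theorem integral_legendreMeasure_eq_intervalIntegral (f : ℝ → ℝ) :
    ∫ x, f x ∂legendreMeasure = ∫ x in (-1 : ℝ)..1, f x := by
  rw [intervalIntegral.integral_of_le (by norm_num : (-1 : ℝ) ≤ 1), ← integral_Icc_eq_integral_Ioc]

/-- `∫_{[-1,1]} conj(P̃_n) P̃_m = δ_{nm}` (Legendre orthogonality and `∫ P_n² = 2/(2n+1)`).
[cite: AndrewsAskeyRoy1999, (2.5.14) (α = β = 0)] -/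
theorem integral_conj_legendreFn_mul_legendreFn (n m : ℕ) :
    ∫ x, conj (legendreFn n x) * legendreFn m x ∂legendreMeasure = if n = m then 1 else 0 := by
  have hfun : (fun x ↦ conj (legendreFn n x) * legendreFn m x) = fun x ↦
      ((legendreNormConst n * legendreNormConst m *
        ((legendre n).eval x * (legendre m).eval x) : ℝ) : ℂ) := by
    funext x
    rw [conj_legendreFn, legendreFn_apply, legendreFn_apply, ← Complex.ofReal_mul]
    congr 1
    ring
  rw [hfun, integral_complex_ofReal, integral_legendreMeasure_eq_intervalIntegral,
    intervalIntegral.integral_const_mul]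
  split_ifs with h
  · subst h
    have h2 : ∫ x in (-1 : ℝ)..1, (legendre n).eval x * (legendre n).eval x = 2 / (2 * n + 1) := by
      rw [← integral_legendre_sq n]
      exact intervalIntegral.integral_congr fun x _ ↦ (sq _).symm
    rw [h2, ← sq, legendreNormConst_sq_mul]
    simp
  · have h0 : ∫ x in (-1 : ℝ)..1, (legendre n).eval x * (legendre m).eval x = 0 := by
      rcases lt_or_gt_of_ne h with hlt | hgt
      · rw [← integral_legendre_mul_legendre_eq_zero hlt]
        exact intervalIntegral.integral_congr fun x _ ↦ mul_comm _ _
      · exact integral_legendre_mul_legendre_eq_zero hgt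
    rw [h0, mul_zero]
    simp

/-- The inner product of `P̃_n` with an `L²` class is the integral against `conj P̃_n`.
[folklore] -/
theorem inner_legendreL2_left (n : ℕ) (f : Lp ℂ 2 legendreMeasure) :
    ⟪legendreL2 n, f⟫_ℂ = ∫ x, conj (legendreFn n x) * f x ∂legendreMeasure := by
  rw [L2.inner_def]
  refine integral_congr_ae ?_
  filter_upwards [coeFn_legendreL2 n] with x hx
  rw [RCLike.inner_apply, hx, mul_comm]

/-- **The normalised Legendre functions are orthonormal in `L²([-1, 1])`.**
[cite: AndrewsAskeyRoy1999, (2.5.14)] -/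
theorem orthonormal_legendreL2 : Orthonormal ℂ legendreL2 := by
  classical
  rw [orthonormal_iff_ite]
  intro n m
  rw [inner_legendreL2_left]
  have h : ∫ x, conj (legendreFn n x) * (legendreL2 m : ℝ → ℂ) x ∂legendreMeasure =
      ∫ x, conj (legendreFn n x) * legendreFn m x ∂legendreMeasure := by
    refine integral_congr_ae ?_
    filter_upwards [coeFn_legendreL2 m] with x hx
    rw [hx]
  rw [h, integral_conj_legendreFn_mul_legendreFn]

/-! ### Polynomials lie in the span, and are dense -/

/-- The `L²([-1,1])` class of the (complexified) polynomial function `x ↦ p(x)`. [folklore] -/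
def polynomialL2 (p : ℝ[X]) : Lp ℂ 2 legendreMeasure :=
  (memLp_legendreMeasure_of_continuous
    (Complex.continuous_ofReal.comp p.continuous) 2).toLp (fun x ↦ ((p.eval x : ℝ) : ℂ))

/-- The class `polynomialL2 p` is represented by `x ↦ p(x)`. [folklore] -/
theorem coeFn_polynomialL2 (p : ℝ[X]) :
    (polynomialL2 p : ℝ → ℂ) =ᵐ[legendreMeasure] fun x ↦ ((p.eval x : ℝ) : ℂ) :=
  MemLp.coeFn_toLp _

/-- **Every real polynomial lies in the linear span of the `P̃_k`** (the `P_k`, `k ≤ n`, span the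
polynomials of degree `≤ n`). [folklore] -/
theorem polynomialL2_mem_span (p : ℝ[X]) :
    polynomialL2 p ∈ Submodule.span ℂ (Set.range legendreL2) := by
  obtain ⟨α, hα⟩ := exists_eq_sum_C_mul_legendre p.natDegree p le_rfl
  -- `p = Σ_{k ≤ n} α_k P_k = Σ (α_k / c_k) P̃_k`
  set n := p.natDegree
  have heq : polynomialL2 p =
      ∑ k ∈ Finset.range (n + 1), ((α k / legendreNormConst k : ℝ) : ℂ) • legendreL2 k := by
    refine Lp.ext ?_
    filter_upwards [coeFn_polynomialL2 p, ae_forall_coeFn_legendreL2,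
      Lp.coeFn_fun_finsetSum (Finset.range (n + 1))
        (fun k ↦ ((α k / legendreNormConst k : ℝ) : ℂ) • legendreL2 k),
      ae_all_iff.2 fun k ↦ Lp.coeFn_smul (((α k / legendreNormConst k : ℝ) : ℂ)) (legendreL2 k)]
      with x hx hleg hsum hsmul
    rw [hx, hsum]
    have hpx : p.eval x = ∑ k ∈ Finset.range (n + 1), α k * (legendre k).eval x := by
      conv_lhs => rw [hα]
      rw [eval_finsetSum]
      simp only [eval_mul, eval_C]
    rw [hpx, Complex.ofReal_sum]
    refine Finset.sum_congr rfl fun k _ ↦ ?_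
    rw [hsmul k, Pi.smul_apply, hleg k, legendreFn_apply, smul_eq_mul, ← Complex.ofReal_mul]
    congr 1
    have hc := legendreNormConst_pos k
    field_simp
  rw [heq]
  exact Submodule.sum_mem _ fun k _ ↦
    Submodule.smul_mem _ _ (Submodule.subset_span (Set.mem_range_self k))

/-- **Polynomials are dense in `L²([-1, 1])`**: every `L²` class is a limit of classes of real
polynomials `p₁ + i p₂` — bounded continuous functions are dense in `L²` of the finite weakly regular
measure (`Lp.boundedContinuousFunction_dense`), and on `[-1, 1]` their real and imaginary parts are
uniform limits of polynomials (Weierstrass, `exists_polynomial_near_of_continuousOn`). [folklore] -/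
theorem polynomial_dense_L2 (f : Lp ℂ 2 legendreMeasure) {ε : ℝ} (hε : 0 < ε) :
    ∃ p₁ p₂ : ℝ[X], ‖f - (polynomialL2 p₁ + Complex.I • polynomialL2 p₂)‖ < ε := by
  -- a bounded continuous `g` with `‖f - g‖ < ε/2`
  have hdense := Lp.boundedContinuousFunction_dense ℂ (p := 2) legendreMeasure (by simp)
  obtain ⟨g, hg, hfg⟩ := Metric.mem_closure_iff.1 (hdense.closure_eq.symm ▸ Set.mem_univ f)
    (ε / 2) (half_pos hε)
  obtain ⟨g₀, hg₀⟩ := (Lp.mem_boundedContinuousFunction_iff).1 hg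
  have hgae : (g : ℝ → ℂ) =ᵐ[legendreMeasure] g₀ := by
    have h1 : ((g : ℝ →ₘ[legendreMeasure] ℂ) : ℝ → ℂ) =ᵐ[legendreMeasure] g₀ := by
      rw [← hg₀]
      exact ContinuousMap.coeFn_toAEEqFun _ _
    exact h1
  -- Weierstrass for the real and imaginary parts on `[-1, 1]`
  set δ : ℝ := ε / 8 with hδ
  have hδpos : 0 < δ := by positivity
  obtain ⟨p₁, hp₁⟩ := exists_polynomial_near_of_continuousOn (-1) 1 (fun x ↦ (g₀ x).re)
    (Complex.continuous_re.comp g₀.continuous).continuousOn δ hδpos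
  obtain ⟨p₂, hp₂⟩ := exists_polynomial_near_of_continuousOn (-1) 1 (fun x ↦ (g₀ x).im)
    (Complex.continuous_im.comp g₀.continuous).continuousOn δ hδpos
  refine ⟨p₁, p₂, ?_⟩
  -- the difference `g - (p₁ + i p₂)` is the class of a function bounded by `2δ` on `[-1,1]`
  set q : ℝ → ℂ := fun x ↦ ((p₁.eval x : ℝ) : ℂ) + Complex.I * ((p₂.eval x : ℝ) : ℂ) with hq
  have hqc : Continuous q := by
    refine (Complex.continuous_ofReal.comp p₁.continuous).add
      (continuous_const.mul (Complex.continuous_ofReal.comp p₂.continuous))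
  have hdiffc : Continuous fun x ↦ g₀ x - q x := g₀.continuous.sub hqc
  have hmem := memLp_legendreMeasure_of_continuous hdiffc 2
  have hclass : g - (polynomialL2 p₁ + Complex.I • polynomialL2 p₂) = hmem.toLp _ := by
    refine Lp.ext ?_
    filter_upwards [Lp.coeFn_sub g (polynomialL2 p₁ + Complex.I • polynomialL2 p₂),
      Lp.coeFn_add (polynomialL2 p₁) (Complex.I • polynomialL2 p₂),
      Lp.coeFn_smul Complex.I (polynomialL2 p₂), coeFn_polynomialL2 p₁, coeFn_polynomialL2 p₂,
      hgae, hmem.coeFn_toLp] with x hsub hadd hsmul h1 h2 hgx hm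
    rw [hsub, Pi.sub_apply, hadd, Pi.add_apply, hsmul, Pi.smul_apply, h1, h2, hgx, hm,
      smul_eq_mul]
  have hbound : ∀ x ∈ Icc (-1 : ℝ) 1, ‖g₀ x - q x‖ ≤ 2 * δ := by
    intro x hx
    have hre : |(g₀ x - q x).re| < δ := by
      have : (g₀ x - q x).re = -(p₁.eval x - (g₀ x).re) := by
        simp [hq, Complex.sub_re, Complex.add_re, Complex.mul_re]
      rw [this, abs_neg]
      exact hp₁ x hx
    have him : |(g₀ x - q x).im| < δ := by
      have : (g₀ x - q x).im = -(p₂.eval x - (g₀ x).im) := by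
        simp [hq, Complex.sub_im, Complex.add_im, Complex.mul_im]
      rw [this, abs_neg]
      exact hp₂ x hx
    calc ‖g₀ x - q x‖ ≤ |(g₀ x - q x).re| + |(g₀ x - q x).im| := Complex.norm_le_abs_re_add_abs_im _
      _ ≤ 2 * δ := by linarith
  have hnorm : ‖g - (polynomialL2 p₁ + Complex.I • polynomialL2 p₂)‖ ≤ Real.sqrt 2 * (2 * δ) := by
    rw [hclass]
    exact norm_toLp_le_of_bound hmem (by positivity) hbound
  have hsqrt : Real.sqrt 2 < 2 := by
    rw [Real.sqrt_lt' two_pos]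
    norm_num
  calc ‖f - (polynomialL2 p₁ + Complex.I • polynomialL2 p₂)‖
      ≤ ‖f - g‖ + ‖g - (polynomialL2 p₁ + Complex.I • polynomialL2 p₂)‖ := norm_sub_le_norm_sub_add_norm_sub _ _ _
    _ < ε / 2 + Real.sqrt 2 * (2 * δ) := add_lt_add_of_lt_of_le (by rwa [← dist_eq_norm]) hnorm
    _ ≤ ε / 2 + 2 * (2 * δ) := by gcongr
    _ = ε := by rw [hδ]; ring

/-- **The span of the `P̃_k` is dense in `L²([-1, 1])`.** [folklore] -/
theorem span_legendreL2_dense :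
    ⊤ ≤ (Submodule.span ℂ (Set.range legendreL2)).topologicalClosure := by
  intro f _
  rw [← SetLike.mem_coe, Submodule.topologicalClosure_coe, Metric.mem_closure_iff]
  intro ε hε
  obtain ⟨p₁, p₂, h⟩ := polynomial_dense_L2 f hε
  refine ⟨polynomialL2 p₁ + Complex.I • polynomialL2 p₂, ?_, by rwa [dist_eq_norm]⟩
  exact Submodule.add_mem _ (polynomialL2_mem_span p₁)
    (Submodule.smul_mem _ _ (polynomialL2_mem_span p₂))

/-! ### The Hilbert basis -/

/-- **The normalised Legendre polynomials form a Hilbert basis of `L²([-1, 1])`** (orthonormal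
with dense span). [cite: ReedSimonI1980, §II.3] -/
def legendreBasis : HilbertBasis ℕ ℂ (Lp ℂ 2 legendreMeasure) :=
  HilbertBasis.mk orthonormal_legendreL2 span_legendreL2_dense

/-- The Hilbert basis is the family `legendreL2`. [folklore] -/
@[simp]
theorem coe_legendreBasis : ⇑legendreBasis = legendreL2 :=
  HilbertBasis.coe_mk _ _

/-- `legendreBasis n = legendreL2 n`. [folklore] -/
theorem legendreBasis_apply (n : ℕ) : legendreBasis n = legendreL2 n := by
  rw [coe_legendreBasis]

/-- **The Legendre coefficients**: `⟨P̃_n, f⟩ = ∫_{[-1,1]} conj(P̃_n(x)) f(x) dx`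
(`= c_n ∫_{-1}^1 P_n f` since `P̃_n` is real). [folklore] -/
theorem legendreBasis_repr (f : Lp ℂ 2 legendreMeasure) (n : ℕ) :
    legendreBasis.repr f n = ∫ x, conj (legendreFn n x) * f x ∂legendreMeasure := by
  rw [HilbertBasis.repr_apply_apply, legendreBasis_apply, inner_legendreL2_left]

/-- Parseval for the Legendre expansion: `‖f‖² = Σ_n |⟨P̃_n, f⟩|²`. [folklore] -/
theorem hasSum_sq_legendreCoeff (f : Lp ℂ 2 legendreMeasure) :
    HasSum (fun n ↦ ‖⟪legendreL2 n, f⟫_ℂ‖ ^ 2) (‖f‖ ^ 2) := by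
  have h := legendreBasis.hasSum_repr f
  have hP : HasSum (fun n ↦ ‖legendreBasis.repr f n‖ ^ 2) (‖f‖ ^ 2) := by
    have hs := lp.hasSum_norm (by norm_num : 0 < (2 : ℝ≥0∞).toReal) (legendreBasis.repr f)
    simp only [ENNReal.toReal_ofNat, Real.rpow_two, LinearIsometryEquiv.norm_map] at hs
    convert hs using 2 with n
  convert hP using 2 with n
  rw [HilbertBasis.repr_apply_apply, legendreBasis_apply]

end Literature.Analysis.SpecialFunctions
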